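import Literature.AnabelianGeometry.EtaleTheta.LogDivisorModelOneComponent
import Literature.AnabelianGeometry.EtaleTheta.DivisorMonoidsOfGaloisCoveringConnected
import Literature.AnabelianGeometry.EtaleTheta.RealifiedDivisorMonoidsOfRlfWeak
import Literature.AnabelianGeometry.EtaleTheta.RealificationPfImageWeak
import Literature.AnabelianGeometry.EtaleTheta.TemperedFrobenioidRestrict
import Literature.AnabelianGeometry.EtaleTheta.Discharge.Sec3Example39DataNonVacuity
import Literature.AnabelianGeometry.EtaleTheta.Discharge.Sec3Lemma35HoldsWeak
import Literature.AnabelianGeometry.EtaleTheta.Discharge.Sec3Cor38CriterionToy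
import Literature.AlgebraicGeometry.Frobenioids.PadicFrobenioidQpSplit
import HarnessLib

/-!
# [EtTh] Def 3.6 (ii): the FIRST tempered Frobenioids over the CONSTRUCTED Def 3.3 (iii) data of the connected
# coverings (`DivisorMonoids.ofGaloisActionConnected`) — at the one-component model, monoid type `ℤ`, both vocabularies

S. Mochizuki, *The étale theta function and its Frobenioid-theoretic manifestations*, Publ. RIMS **45** (2009)
[MochizukiEtTh2009], Def. 3.3 (iii) PDF p. 73, Def. 3.6 (i)(ii) pp. 76–77 ("Let `D` be a connected, totally epimorphic
category, equipped with a functor `D → D₀`; `Φ ⊆ Φ^{ℝ-log} := Φ₀^ℝ|_D` a group-saturated subfunctor in monoids which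
determines a perf-factorial divisorial monoid on `D` such that (a) `Φ^{bs-fld}` is monoprime; (b) `F(A) → (Φ^{bs-fld})^gp(A)`
is nonzero … the data `(D, Φ, B, B → Φ^gp)` determines a model Frobenioid `C`") [cite: MochizukiEtTh2009, Def 3.6 p.77];
S. Mochizuki, *The geometry of Frobenioids II* (2008), Ex. 1.1 (the `p`-adic Frobenioid) [cite: MochizukiFrdII2008, Ex. 1.1 p.408].

abc-iut cell, block C / W6, seat abc-iut-w6-d048 (gen 3).  CLASS (b) MODEL / NON-VACUITY construction; every landed
declaration is consumed BY NAME (abc-iut-w6-d058's `GaloisAction.trivial`, `DivisorMonoids.ofGaloisActionConnected`,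
`isConnectedGSet_leftRegular`; abc-iut-L6-t12's `ofRlfZ` / `ofRlfZWeak`; abc-iut-w5-d164's / abc-iut-L2-d2's generic
`Example39NV.*` / `PfImageWeak.*` image-of-the-perfection lemmas; this seat's `TemperedFrobenioid.restrictConnectedPart`).

REPAIR OF FINDING F-w6d048g3-1 (vacuity): the only `LogDivisorModel` in the tree was the degenerate `toy` (`DIV = 1`), over
which `Φ₀ = Hom_G(−, Div⁺)` is trivial and Def. 3.6 (ii)(b) unsatisfiable — so "for every tempered Frobenioid over the
constructed connected data" (abc-iut-w5-d179's p439044 / `Sec3OfGaloisCoveringConnectedRealified`, this seat's p439556 /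
p439892) quantified over an EMPTY class.  Here, at the NON-DEGENERATE one-component model `LogDivisorModel.oneComp U hU`
(`LogDivisorModelOneComponent.lean`: smooth reduction, `Z_∞ = X`, `Gal = 1`, `DIV = ℤ·[F]`, `Mero = L^× = U × ϖ^ℤ`), with
the trivial Galois action of `G = 1` (`D₀` = connected `1`-sets = points):
* §1 `phiZeroEquivNat`: `Φ₀(S) = Hom_1(S, ℤ_{≥0}·[F]) ≅ ℕ` for every connected `S`; hence `Φ₀(S)` is MONOPRIME, perf-factorial
  (printed AND weak sense): the hypotheses `hpf` of BOTH Def. 3.6 (i) constructors are THEOREMS here (`hpf_oneComp`,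
  `hpfCof_oneComp`);
* §2 **`temperedFrobenioidOneComp`** `: TemperedFrobenioid (ofRlfZ (ofGaloisActionConnected (trivial (oneComp U hU) 1) _)
  hpf_oneComp) (Discrete PUnit) (treeCatVocab …)` — `D` = one object over the point `G/1 ∈ D₀`, `Φ := im(Φ₀^pf → Φ₀^rlf)
  ≅ ℚ_{≥0}` inside `Φ^{ℝ-log} = Φ₀(pt)^rlf ≅ ℝ_{≥0}` (group-saturated, perf-factorial, divisorial), (a) `Φ^{bs-fld} = Φ`
  monoprime (all functions are constant, so every divisor class is base-field-theoretic), (b) the uniformizer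
  `ϖ ∈ F₀ = B₀` has divisor `ι([F])/1 ≠ 1` — print's `p`-adic Frobenioid ([FrdII] Ex. 1.1) of a good-reduction curve,
  now LITERALLY over the constructed connected Def. 3.3 (iii) data; **`temperedFrobenioidOneCompWeak`** — the same over the
  WEAK data of record `ofRlfZWeak … hpfCof_oneComp`;
* §3 non-vacuity of the cell's theorem families: `Nonempty` for both, the re-based witnesses over print's genuine base
  `ConnectedPart (BTemp Π)` for EVERY topological group `Π` (`restrictConnectedPart`, constant functor to the point), and
  «`C` IS a Frobenioid» at these inhabitants ([FrdI] Thm. 5.2 (ii), `ModelFrobenioid.isFrobenioid`).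
HONEST LABEL: genuine vocabularies and the constructed data, but DEGENERATE GEOMETRY (one component, no cusps, every
log-meromorphic function constant; `D` one object); a consistency / instantiation witness, NOT the tempered Frobenioid
of a Tate curve; Def. 4.1 bi-Kummer data are NOT claimed inhabited here.  Nothing here bears on [IUTchIII] Cor. 3.12; no
side taken; typed ≠ proved for anything else.
-/

noncomputable section

namespace Literature.AnabelianGeometry.EtaleTheta

open CategoryTheory Opposite Function Literature.AlgebraicGeometry.Frobenioids
  Literature.AnabelianGeometry.SemiGraphs LogDivisorModel LogDivisorModel.GaloisAction

namespace OneCompFrd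

variable (U : Type) [CommGroup U] (hU : ∀ u : U, (∀ N : ℕ+, ∃ g : U, g ^ (N : ℕ) = u) → u = 1)

/-- The trivial action of `G = Gal(Z_∞/X) = 1` on the one-component model (`Z_∞ = X`). [cite: MochizukiEtTh2009, Def 3.3 p.73] -/
abbrev act : (oneComp U hU).GaloisAction PUnit.{1} := GaloisAction.trivial (oneComp U hU) PUnit

/-- `D₀` proper at this term: the connected `1`-sets (points). [cite: MochizukiEtTh2009, Def 3.3 p.73] -/
abbrev D₀ : Type 1 := (isConnectedGSet (G := PUnit.{1})).FullSubcategory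

/-- The Def. 3.3 (iii) data of the connected coverings at the one-component model (abc-iut-w6-d058's constructor).
[cite: MochizukiEtTh2009, Def 3.3 p.73] -/
abbrev dm : DivisorMonoids.{1, 0, 0} D₀ :=
  DivisorMonoids.ofGaloisActionConnected (act U hU) (cuspLaws_oneComp U hU)

/-- The point `G/1` of `D₀` (the covering `Z_∞ = X` itself). [cite: MochizukiEtTh2009, Def 3.3 p.73] -/
abbrev pt : D₀ := ⟨Action.leftRegular PUnit.{1}, isConnectedGSet_leftRegular⟩

/-! ### §1 `Φ₀(S) ≅ ℕ` for every connected `S`; the `hpf` hypotheses are theorems -/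

section PhiZero

variable {U hU}

/-- In a connected `1`-set all points coincide. [cite: MochizukiEtTh2009, Def 3.3 p.73] -/
theorem eq_of_isConnectedGSet_punit {S : Action (Type 0) PUnit.{1}} (hS : isConnectedGSet S) (s t : S.V) : s = t := by
  obtain ⟨g, hg⟩ := hS.2 s t
  rw [← hg, show g = 1 from rfl, map_one]
  rfl

variable (U hU)

/-- The value `φ(s₀) ∈ ℤ_{≥0}·[F]` of `φ ∈ Φ₀(S)` at the (unique) point, as a natural number (multiplicity along `F`).
[cite: MochizukiEtTh2009, Def 3.3 p.73] -/
def multAt (S : D₀) (φ : (act U hU).phiZero S.obj) : ℕ :=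
  Int.toNat (OneComp.val (φ.1 S.property.1.some))

/-- `multAt` recovers the value at EVERY point (connectedness) as the log-divisor `n·[F]`. [cite: MochizukiEtTh2009, Def 3.3 p.73] -/
theorem ofAdd_multAt (S : D₀) (φ : (act U hU).phiZero S.obj) (s : S.obj.V) :
    (Multiplicative.ofAdd ((multAt U hU S φ : ℕ) : ℤ) : (oneComp U hU).DIV) = φ.1 s := by
  have h0 : 0 ≤ OneComp.val (φ.1 s) := (φ.2.1 s).2
  rw [multAt, eq_of_isConnectedGSet_punit S.property S.property.1.some s, Int.toNat_of_nonneg h0]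
  exact ofAdd_toAdd _

/-- `n·[F]` is an effective Cartier log-divisor of the one-component model. [cite: MochizukiEtTh2009, Def 3.1 p.70] -/
theorem ofAdd_natCast_mem_Divplus (n : ℕ) :
    (Multiplicative.ofAdd (n : ℤ) : (oneComp U hU).DIV) ∈ (oneComp U hU).Divplus :=
  ⟨trivial, Int.natCast_nonneg n⟩

/-- The constant `G`-equivariant map with value `n·[F]`, an element of `Φ₀(S)`. [cite: MochizukiEtTh2009, Def 3.3 p.73] -/
def constPhi (S : D₀) (n : ℕ) : (act U hU).phiZero S.obj :=
  ⟨fun _ => (Multiplicative.ofAdd (n : ℤ) : Multiplicative ℤ), fun _ => ofAdd_natCast_mem_Divplus U hU n, fun _ _ => rfl⟩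

/-- **`Φ₀(S) ≅ ℕ`** for every connected `S` (one orbit of prime log-divisors: Rmk. 3.3.1).
[cite: MochizukiEtTh2009, Rmk 3.3.1 p.73] -/
def phiZeroEquivNat (S : D₀) : (act U hU).phiZero S.obj ≃* Multiplicative ℕ where
  toFun φ := Multiplicative.ofAdd (multAt U hU S φ)
  invFun n := constPhi U hU S (Multiplicative.toAdd n)
  left_inv φ := Subtype.ext (funext fun s => by
    show (constPhi U hU S (Multiplicative.toAdd (Multiplicative.ofAdd (multAt U hU S φ)))).1 s = φ.1 s
    rw [toAdd_ofAdd]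
    exact ofAdd_multAt U hU S φ s)
  right_inv n := by
    change Multiplicative.ofAdd (Int.toNat (OneComp.val (Multiplicative.ofAdd ((Multiplicative.toAdd n : ℕ) : ℤ)))) = n
    rw [OneComp.val_ofAdd, Int.toNat_natCast, ofAdd_toAdd]
  map_mul' φ ψ := by
    rw [← ofAdd_add]
    congr 1
    have hφ : (0 : ℤ) ≤ OneComp.val (φ.1 S.property.1.some) := (φ.2.1 _).2
    have hψ : (0 : ℤ) ≤ OneComp.val (ψ.1 S.property.1.some) := (ψ.2.1 _).2
    change Int.toNat (OneComp.val (φ.1 S.property.1.some * ψ.1 S.property.1.some)) = _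
    rw [show OneComp.val (φ.1 S.property.1.some * ψ.1 S.property.1.some) =
        OneComp.val (φ.1 S.property.1.some) + OneComp.val (ψ.1 S.property.1.some) from toAdd_mul _ _,
      Int.toNat_add hφ hψ]
    rfl

/-- **`Φ₀(Y)` is MONOPRIME** for every connected `Y`. [cite: MochizukiEtTh2009, Rmk 3.3.1 p.73] -/
theorem isMonoprime_Φ₀ (Y : D₀ᵒᵖ) : IsMonoprime ((dm U hU).Φ₀.obj Y) :=
  IsMonoprime.of_mulEquiv (phiZeroEquivNat U hU Y.unop).symm isMonoprime_multiplicative_nat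

/-- **Prop. 3.4 (i) "`Φ₀(Y)` is perf-factorial" in the PRINTED sense holds here** — the hypothesis `hpf` of the strong
Def. 3.6 (i) constructor `ofRlfZ`. [cite: MochizukiEtTh2009, Prop 3.4 p.74] -/
theorem hpf_oneComp (Y : D₀ᵒᵖ) : IsPerfFactorial ((dm U hU).Φ₀.obj Y) :=
  MonoprimeStructure.isPerfFactorial (isMonoprime_Φ₀ U hU Y)

/-- … and in the WEAK sense of record (`hpf` of `ofRlfZWeak`). [cite: MochizukiEtTh2009, Prop 3.4 p.74] -/
theorem hpfCof_oneComp (Y : D₀ᵒᵖ) : IsPerfFactorialCof ((dm U hU).Φ₀.obj Y) :=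
  isPerfFactorialCof_of_isPerfFactorial (hpf_oneComp U hU Y)

end PhiZero

/-! ### §2 The tempered Frobenioid (monoid type `ℤ`), printed vocabulary -/

/-- The Def. 3.6 (i) data of monoid type `ℤ` CONSTRUCTED over the one-component model's connected Def. 3.3 (iii) data
(printed perf-factorial slot discharged by `hpf_oneComp`). [cite: MochizukiEtTh2009, Def 3.6 p.76] -/
abbrev T : RealifiedDivisorMonoids (D₀ := D₀) treeMonoidVocab.{0} :=
  RealifiedDivisorMonoids.ofRlfZ (dm U hU) (hpf_oneComp U hU)

/-- The base functor `D = {pt} → D₀`, `pt ↦ G/1`. [cite: MochizukiEtTh2009, Def 3.6 p.76] -/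
abbrev base : Discrete PUnit.{1} ⥤ D₀ := (Functor.const (Discrete PUnit.{1})).obj pt

/-- `Φ(A) := im(Φ₀(pt)^pf → Φ₀(pt)^rlf) ⊆ Φ^{ℝ-log}(A) = Φ₀(pt)^rlf`. [cite: MochizukiEtTh2009, Def 3.6 p.76] -/
def pfImage : Submonoid ((T U hU).ΦR.obj (op pt)) :=
  MonoidHom.mrange (hpf_oneComp U hU (op pt)).toRealification

/-- The constant function `u·ϖⁿ` on the point, an element of `B₀(pt) = Mero(Z_∞)^1`. [cite: MochizukiEtTh2009, Def 3.3 p.73] -/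
def cnstFn (u : U) (n : ℤ) : (act U hU).bZero pt.obj :=
  ⟨fun _ => ((u, Multiplicative.ofAdd n) : U × Multiplicative ℤ), fun _ => trivial, fun _ _ => rfl⟩

/-- `div₀(u·ϖⁿ) = n·[F] / 1` for `n ≥ 0`: the divisor of a constant function is its valuation times the special fibre.
[cite: MochizukiEtTh2009, Def 3.3 p.73] -/
theorem div₀_cnstFn (u : U) (n : ℕ) :
    (dm U hU).div₀ (op pt) (cnstFn U hU u n) =
      Algebra.GrothendieckGroup.of (constPhi U hU pt n : (dm U hU).Φ₀.obj (op pt)) :=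
  (((act U hU).divZeroHom_eq_div_iff _ _ (constPhi U hU pt n) 1).2 fun _ => mul_one _).trans
    (by rw [map_one, div_one])

/-- Every element of `Φ(A)` is base-field-theoretic: its class lies in `ℝ·Φ₀^cnst` (all log-meromorphic functions are
constant, so `Φ₀^cnst = Φ₀^birat = Φ₀^gp`; `ℝ·Φ₀^cnst` is root-closed). [cite: MochizukiEtTh2009, Def 3.6 p.77] -/
theorem of_mem_cnstR_of_mem_pfImage {x : (T U hU).ΦR.obj (op pt)} (hx : x ∈ pfImage U hU) :
    Algebra.GrothendieckGroup.of x ∈ (T U hU).cnstR (op pt) := by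
  obtain ⟨a, rfl⟩ := hx
  obtain ⟨⟨m, n⟩, rfl⟩ := Perfection.mk_surjective a
  apply (T U hU).mem_cnstR_of_pow_mem _ n.ne_zero
  rw [← map_pow, ← map_pow, Perfection.mk_pow_self]
  have hm : m = constPhi U hU pt (multAt U hU pt m) :=
    ((phiZeroEquivNat U hU pt).symm_apply_apply m).symm
  have key : EtaleTheta.gpMap ((T U hU).toR (op pt)) ((dm U hU).div₀ (op pt) (cnstFn U hU 1 (multAt U hU pt m))) ∈
      (T U hU).cnstR (op pt) :=
    (T U hU).cnst_le_cnstR (op pt) (cnstFn U hU 1 (multAt U hU pt m)) fun _ => trivial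
  have h : EtaleTheta.gpMap ((T U hU).toR (op pt)) ((dm U hU).div₀ (op pt) (cnstFn U hU 1 (multAt U hU pt m))) =
      Algebra.GrothendieckGroup.of ((hpf_oneComp U hU (op pt)).toRealification (Perfection.of _ m)) := by
    rw [div₀_cnstFn, ← hm]
    exact EtaleTheta.gpMap_of _ _
  exact (congrArg (· ∈ (T U hU).cnstR (op pt)) h).mp key

/-- Hence `Φ ∩ ℝ·Φ₀^cnst = Φ` ("`Φ^{bs-fld} = Φ`"). [cite: MochizukiEtTh2009, Def 3.6 p.77] -/
theorem pfImage_inf_cnstR_eq :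
    pfImage U hU ⊓ ((T U hU).cnstR (op pt)).toSubmonoid.comap Algebra.GrothendieckGroup.of = pfImage U hU :=
  inf_eq_left.mpr fun _ hx => of_mem_cnstR_of_mem_pfImage U hU hx

/-- `Φ(A)` is monoprime (`≅ ℚ_{≥0}`). [cite: MochizukiEtTh2009, Def 3.6 p.77] -/
theorem isMonoprime_pfImage : IsMonoprime ↥(pfImage U hU) :=
  Example39NV.isMonoprime_mrange_toRealification (isMonoprime_Φ₀ U hU _)

/-- The uniformizer's log-divisor `ι([F]) ∈ Φ(A)` is not `1`. [cite: MochizukiEtTh2009, Def 3.6 p.77] -/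
theorem toRealification_uniformizer_ne_one :
    (hpf_oneComp U hU (op pt)).toRealification (Perfection.of _ (constPhi U hU pt 1)) ≠ 1 := by
  intro h
  have h1 := Example39NV.toRealification_injective (hpf_oneComp U hU _) (h.trans (map_one _).symm)
  have h2 : constPhi U hU pt 1 = 1 :=
    (Perfection.mk_eq_one_iff_of_isSharp (MonoprimeStructure.isSharp (isMonoprime_Φ₀ U hU (op pt)))).mp h1
  have h3 := congrArg (fun φ : (act U hU).phiZero pt.obj => OneComp.val (φ.1 PUnit.unit)) h2
  change OneComp.val (Multiplicative.ofAdd ((1 : ℕ) : ℤ)) = OneComp.val 1 at h3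
  rw [OneComp.val_ofAdd, OneComp.val_one] at h3
  exact one_ne_zero h3

/-- `Φ ⊆ Φ^{ℝ-log}|_D` as a subfunctor in monoids over the constant base functor. [cite: MochizukiEtTh2009, Def 3.6 p.76] -/
def Φsub : SubMonoidOn (base.op ⋙ (T U hU).ΦR) where
  carrier _ := pfImage U hU
  map_mem := by
    rintro A B f _ ⟨a, rfl⟩
    exact ⟨Perfection.map ((dm U hU).Φ₀.map (base.map f.unop).op).hom a,
      (DFunLike.congr_fun (rlfMap_comp_toRealification (dm U hU).Φ₀ (hpf_oneComp U hU) (base.map f.unop).op) a).symm⟩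

variable (R S : ((Discrete PUnit.{1})ᵒᵖ ⥤ CommMonCat.{0}) → Prop)

/-- **The tempered Frobenioid of the one-component model over the CONSTRUCTED connected Def. 3.3 (iii) data** (monoid
type `ℤ`, printed vocabulary): Def. 3.6 (ii) with `D = {pt} → D₀`, `Φ = im(Φ₀^pf → Φ₀^rlf)`; (a) and (b) PROVED.
[cite: MochizukiEtTh2009, Def 3.6 p.77] -/
def temperedFrobenioidOneComp : TemperedFrobenioid (T U hU) (Discrete PUnit.{1}) (treeCatVocab (Discrete PUnit.{1}) R S) where
  isConnected := Toy.temperedFrobenioid.isConnected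
  isTotallyEpimorphic := Toy.temperedFrobenioid.isTotallyEpimorphic
  base := base
  Φ := Φsub U hU
  isGroupSaturated _ := Example39NV.isGroupSaturated_mrange_toRealification (hpf_oneComp U hU _)
  isPerfFactorial _ := Example39NV.isPerfFactorial_mrange_toRealification (isMonoprime_Φ₀ U hU _)
  isDivisorialOn := by
    rw [treeCatVocab_isDivisorialOn]
    exact ⟨Cor38Toy.isMonoidOn_of_punit _, fun _ => MonoprimeStructure.isDivisorial (isMonoprime_pfImage U hU)⟩
  isMonoprime_bsFld _ :=
    IsMonoprime.of_mulEquiv (MulEquiv.submonoidCongr (pfImage_inf_cnstR_eq U hU).symm) (isMonoprime_pfImage U hU)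
  exists_FΛ_div_ne _ := by
    refine ⟨cnstFn U hU 1 ((1 : ℕ) : ℤ), fun _ => trivial,
      (hpf_oneComp U hU (op pt)).toRealification (Perfection.of _ (constPhi U hU pt 1)), ⟨_, rfl⟩, 1,
      one_mem _, toRealification_uniformizer_ne_one U hU, ?_⟩
    change EtaleTheta.gpMap ((T U hU).toR (op pt)) ((dm U hU).div₀ (op pt) (cnstFn U hU 1 ((1 : ℕ) : ℤ))) = _
    rw [div₀_cnstFn, map_one, div_one]
    exact EtaleTheta.gpMap_of _ _

/-- **NON-VACUITY: a tempered Frobenioid over the constructed connected Def. 3.3 (iii) data EXISTS** (printed vocabulary).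
[cite: MochizukiEtTh2009, Def 3.6 p.77] -/
theorem nonempty_temperedFrobenioid_ofGaloisActionConnected :
    Nonempty (TemperedFrobenioid (RealifiedDivisorMonoids.ofRlfZ
      (DivisorMonoids.ofGaloisActionConnected (act U hU) (cuspLaws_oneComp U hU)) (hpf_oneComp U hU))
      (Discrete PUnit.{1}) (treeCatVocab (Discrete PUnit.{1}) R S)) :=
  ⟨temperedFrobenioidOneComp U hU R S⟩

end OneCompFrd

end Literature.AnabelianGeometry.EtaleTheta

end
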